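import Summits.ResolutionOfSingularities.ResolutionOfSingularities.Theses.UniversalCells
import Literature.AlgebraicGeometry.Resolution.ResolutionLocalization
import Literature.AlgebraicGeometry.Resolution.PrincipalizationToResolution
import Summits.ResolutionOfSingularities.ResolutionOfSingularities.Theorems.UniversalCellsProductDescentAffineInduction
import Summits.ResolutionOfSingularities.ResolutionOfSingularities.Theorems.UniversalCellsProductDescentResolutionOfFlatCharts
import HarnessLib

/-!
# Crux `ProductDescent` (stmt-ResolutionOfSingularities-15231) — line `vertical-lines`
(crux-strategist's skeleton, ADOPTED by the lead 2026-08-17 ~10:45Z after `birth` reached rev L7;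
rev VL2: both true stubs landed in wave 3 — p155056, p155001 — the only `sorry` left is
`stub_verticalLines`)

Route `ResolutionOfSingularities/UniversalCells`, crux #3 (rank 3): PRODUCT DESCENT, local form —
for `Y` integral separated of finite type over `𝔽_p = ZMod p`, `W ↪ 𝔸ˢ_Y` open, `w ∈ W`: if `w`
has an open neighbourhood `W'` in `W` with a resolution, then the image `y` of `w` in `Y` has an
open neighbourhood in `Y` with a resolution.

## The cut: FLAT-CHART DESCENT OF REGULARITY ("the resolution of `Y` is the space of vertical
lines of the resolution of `Y × 𝔸¹`"), no slicing, no specialisation, no finite-field descent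

Let `π : Z → W'` be the given resolution and `φ : Z → Y` the composite with the projection.
Regularity DESCENDS along flat local homomorphisms (Matsumura 23.7 (i), in tree:
`Literature…IsRegularLocalRing.of_flat_of_isLocalHom`). So a proper birational `g : U' → U`
(`U ∋ y` open in `Y`) is a resolution near the fibre over `y` as soon as every point `u'` of that
fibre is the image of a point of some REGULAR scheme under a morphism FLAT at that point — and the
regular scheme at hand is `Z` itself. The line asks for such FLAT CHARTS FROM OPENS OF `Z`,
compatible with `φ` ("vertical-lines principle"); the intended witness for `U'` is the
normalised closure `U*` of the flat locus of `φ` in the relative Hilbert scheme of a relative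
compactification `Z̄ → Y` (the MINIMAL flattener of `φ`, Raynaud–Gruson 1971 Thm 5.2.2 /
Hironaka 1975: the strict transform `Z* → U*` is flat and `Z* → Z̄` is the graph closure of the
rational map `Z ⇢ U*`), and a flat chart at `u* ∈ U*` exists iff the limit curve `Z*_{u*}`
(flat limit of the vertical lines `{u} × 𝔸¹`) has a point of `Z` at which `Z ⇢ U*` is defined
("private point"). Worked by hand (line card): `Bl_0 𝔸ⁿ⁺¹ → 𝔸ⁿ` (gives `U* = Bl_0 𝔸ⁿ`), a
two-step tower, and the twisted product `Bl_S(U × 𝔸¹)`, `U` the 3-fold node, `S` a rotating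
plane (gives the SMALL resolution) — all private. The statement is characteristic-free and does
not mention residue fields: it evades `InseparableBaseChange` (no fibre over a non-closed point is
ever asked to be geometrically regular) and the finite-field rationality defect of every slicing
line (no section of `𝔸¹_Y → Y` through `W'` is needed).

* `stub_affineInduction` — INDUCTION ON `s` (true, M): the case `s = 1` of the crux implies the
  crux for all `s` (`𝔸ˢ⁺¹_Y ≅ 𝔸¹_{𝔸ˢ_Y}` over `Y`, `𝔸ˢ_Y` is again integral separated of finite
  type over `𝔽_p`; `s = 0`: `𝔸⁰_Y ≅ Y`). Transfer stub: it lets the load-bearing stub speak about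
  limit CURVES.
* `stub_resolutionOfFlatCharts` — FLAT CHARTS ALONG A FIBRE GIVE A RESOLUTION OF A NEIGHBOURHOOD
  (true, M): `X` locally of finite type over `𝔽_p`, `g : U' → X` proper birational, every point
  of `g⁻¹(x)` the image of a regular-stalk point under a morphism flat there ⇒ some open `U₁ ∋ x`
  has a resolution (flat descent of regularity at the fibre; the regular locus of `U'` is open —
  in tree `isOpen_regularLocus_of_locallyOfFiniteType_perfectField`; `g` is closed; restrict `g`
  over `X ∖ g(Sing U')`: `IsBirational.morphismRestrict`, `Scheme.IsRegular.of_isOpenImmersion`).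
* `stub_verticalLines` — THE VERTICAL-LINES PRINCIPLE for `s = 1` (load-bearing, OPEN,
  characteristic-free): for EVERY resolution `π : Z → W'` of an open `W' ∋ w` of `W ⊆ 𝔸¹_Y`
  there are an open `U ∋ y` of `Y` and a proper birational `g : U' → U` such that every point of
  `U'` over `y` is hit by a `φ`-compatible morphism `a : V → U'`, `V ⊆ Z` open, flat on `V`.
  Not implied by the summit for a GIVEN `Z` (a pathological `Z` could refute it alone — the
  line's cheapest falsifier, runnable in characteristic 0), implies the crux with the two true
  stubs.
* `ProductDescent_of` — kernel-checked composition, no `sorry` of its own.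

Disproof used: none on file for this crux (2026-08-17: `ledger crux ls` shows Lines/birth.*,
PICKED.md; no `Disproof.lean`, no `Negative/`; `ledger negatives` has 1 unrelated entry).
-/

noncomputable section

-- single-problem summit: the doubled namespace component `ResolutionOfSingularities` is forced
set_option linter.dupNamespace false

open CategoryTheory CategoryTheory.Limits AlgebraicGeometry Literature.AlgebraicGeometry.Resolution
open Summit.ResolutionOfSingularities.ResolutionOfSingularities.Theses.UniversalCells (ProductDescent)

namespace Summit.ResolutionOfSingularities.ResolutionOfSingularities.Cruxes.ProductDescent.Lines.VerticalLines

/-! ## The stubs (registered signatures; prove EXACTLY these, with the `open`s above) -/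

/-- **CLOSED STUB (landed p155056, `Theorems/UniversalCellsProductDescentAffineInduction.lean`; was: true, M) — induction on the number of affine variables.** Product descent for opens
of `𝔸¹_Y` (all `Y`) implies product descent for opens of `𝔸ˢ_Y` (all `s`, all `Y`): write
`𝔸ˢ⁺¹_Y ≅ 𝔸¹_{𝔸ˢ_Y}` over `Y` (`AffineSpace.homOfVector` both ways), apply the case `s = 1` over
the integral separated finite-type `𝔽_p`-scheme `𝔸ˢ_Y` to get a resolvable open of `𝔸ˢ_Y`
through the image of `w`, and conclude by the induction hypothesis applied to that open (with
`W' = W`); `s = 0` is transport along the isomorphism `𝔸⁰_Y ↘ Y`. [folklore] -/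
theorem stub_affineInduction :
    (∀ p : ℕ, p.Prime → ∀ (Y : Scheme.{0}) (f : Y ⟶ Spec (.of (ZMod p))),
      IsSeparated f → LocallyOfFiniteType f → QuasiCompact f → IsIntegral Y →
      ∀ (W : Scheme.{0}) (j : W ⟶ 𝔸(Fin 1; Y)), IsOpenImmersion j → ∀ w : W,
      (∃ W' : W.Opens, w ∈ W' ∧ Scheme.HasResolution (W' : Scheme.{0})) →
      ∃ U : Y.Opens, (𝔸(Fin 1; Y) ↘ Y).base (j.base w) ∈ U ∧
        Scheme.HasResolution (U : Scheme.{0})) →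
    ∀ p : ℕ, p.Prime → ∀ (Y : Scheme.{0}) (f : Y ⟶ Spec (.of (ZMod p))),
      IsSeparated f → LocallyOfFiniteType f → QuasiCompact f → IsIntegral Y →
      ∀ (s : ℕ) (W : Scheme.{0}) (j : W ⟶ 𝔸(Fin s; Y)), IsOpenImmersion j → ∀ w : W,
      (∃ W' : W.Opens, w ∈ W' ∧ Scheme.HasResolution (W' : Scheme.{0})) →
      ∃ U : Y.Opens, (𝔸(Fin s; Y) ↘ Y).base (j.base w) ∈ U ∧
        Scheme.HasResolution (U : Scheme.{0}) :=
  Summit.ResolutionOfSingularities.ResolutionOfSingularities.Theorems.ProductDescent.VerticalLines.stub_affineInduction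

/-- **CLOSED STUB (landed p155001, `Theorems/UniversalCellsProductDescentResolutionOfFlatCharts.lean`; was: true, M) — flat charts by regular schemes along a fibre of a proper birational
morphism give a resolution of a neighbourhood.** `X` locally of finite type over `𝔽_p`,
`g : U' → X` proper birational; if every `u' ∈ g⁻¹(x)` is `a(v)` for a morphism `a : V → U'`
flat (on `V`) with `𝒪_{V,v}` regular, then `𝒪_{U',u'}` is regular (Matsumura 23.7 (i):
`IsRegularLocalRing.of_flat_ringHom` with `Flat.stalkMap`; stalks of `U'` are Noetherian), the
regular locus of `U'` is open (`isOpen_regularLocus_of_locallyOfFiniteType_perfectField`, `𝔽_p`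
perfect), its complement has closed image not containing `x` (`g` universally closed), and over
the complementary open `U₁ ∋ x` the restriction `g ∣_ U₁` is proper, birational
(`IsBirational.morphismRestrict`) with regular source. [cite: Matsumura1987, Thm. 23.7 (i)] -/
theorem stub_resolutionOfFlatCharts :
    ∀ p : ℕ, p.Prime → ∀ (X : Scheme.{0}) (f : X ⟶ Spec (.of (ZMod p))),
      LocallyOfFiniteType f → ∀ (x : X) (U' : Scheme.{0}) (g : U' ⟶ X),
      IsProper g → IsBirational g →
      (∀ u' : U', g.base u' = x → ∃ (V : Scheme.{0}) (a : V ⟶ U') (v : V),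
          Flat a ∧ a.base v = u' ∧ IsRegularLocalRing (V.presheaf.stalk v)) →
      ∃ U₁ : X.Opens, x ∈ U₁ ∧ Scheme.HasResolution (U₁ : Scheme.{0}) :=
  Summit.ResolutionOfSingularities.ResolutionOfSingularities.Theorems.ProductDescent.VerticalLines.stub_resolutionOfFlatCharts

/-- **STUB (load-bearing, OPEN; characteristic-free) — the vertical-lines principle.** For
`Y` integral separated of finite type over `𝔽_p`, `j : W ↪ 𝔸¹_Y` open, `w ∈ W' ⊆ W` open and
ANY resolution `π : Z → W'`, there are an open `U ∋ y` of `Y` (`y` the image of `w`) and a proper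
birational `g : U' → U` such that every point of `U'` over `y` is the image of a point of an open
`V ⊆ Z` under a morphism `a : V → U'` which is flat and compatible with `φ = pr ∘ j ∘ π`.
Intended witness: `U' = U*` the normalised closure of the flat locus of `φ` in the relative
Hilbert scheme of a relative compactification of `Z` over `U` (minimal flattener; Raynaud–Gruson
Thm 5.2.2 gives flatteners by blowing up), `V` = the locus where `Z ⇢ U*` is a morphism, which is
flat there because the graph closure `Z* → U*` is the (flat) universal family; the content is
that every limit curve over `y` has such a "private" point inside `Z`.
[cite: RaynaudGruson1971, Thm. 5.2.2; Kollar2007, 3.4 and Prop. 3.9.2 (descent along smooth morphisms needs functoriality)] -/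
theorem stub_verticalLines :
    ∀ p : ℕ, p.Prime → ∀ (Y : Scheme.{0}) (f : Y ⟶ Spec (.of (ZMod p))),
      IsSeparated f → LocallyOfFiniteType f → QuasiCompact f → IsIntegral Y →
      ∀ (W : Scheme.{0}) (j : W ⟶ 𝔸(Fin 1; Y)), IsOpenImmersion j →
      ∀ (w : W) (W' : W.Opens), w ∈ W' →
      ∀ (Z : Scheme.{0}) (π : Z ⟶ (W' : Scheme.{0})), IsResolution π →
      ∃ U : Y.Opens, (𝔸(Fin 1; Y) ↘ Y).base (j.base w) ∈ U ∧
        ∃ (U' : Scheme.{0}) (g : U' ⟶ (U : Scheme.{0})), IsProper g ∧ IsBirational g ∧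
          ∀ u' : U', (g ≫ U.ι).base u' = (𝔸(Fin 1; Y) ↘ Y).base (j.base w) →
            ∃ (V : Z.Opens) (a : (V : Scheme.{0}) ⟶ U') (v : V),
              Flat a ∧ a.base v = u' ∧
              a ≫ g ≫ U.ι = V.ι ≫ π ≫ W'.ι ≫ j ≫ (𝔸(Fin 1; Y) ↘ Y) := by
  sorry

/-! ## Composition (kernel-checked; no `sorry` of its own) -/

/-- **The case `s = 1` of the crux**, from `stub_verticalLines` and
`stub_resolutionOfFlatCharts`: unpack the resolution `π : Z → W'`, take the modification
`g : U' → U` and the flat charts from opens of `Z` (regular: open subschemes of the regular `Z`),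
feed them to flat-chart descent over the open `U` (locally of finite type over `𝔽_p` as an open of
`Y`), and push the resulting resolvable open `U₁ ∋ y` of `U` forward to an open of `Y`.
[cite: Matsumura1987, Thm. 23.7 (i)] -/
theorem productDescent_one
    (h2 : ∀ p : ℕ, p.Prime → ∀ (X : Scheme.{0}) (f : X ⟶ Spec (.of (ZMod p))),
      LocallyOfFiniteType f → ∀ (x : X) (U' : Scheme.{0}) (g : U' ⟶ X),
      IsProper g → IsBirational g →
      (∀ u' : U', g.base u' = x → ∃ (V : Scheme.{0}) (a : V ⟶ U') (v : V),
          Flat a ∧ a.base v = u' ∧ IsRegularLocalRing (V.presheaf.stalk v)) →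
      ∃ U₁ : X.Opens, x ∈ U₁ ∧ Scheme.HasResolution (U₁ : Scheme.{0}))
    (h3 : ∀ p : ℕ, p.Prime → ∀ (Y : Scheme.{0}) (f : Y ⟶ Spec (.of (ZMod p))),
      IsSeparated f → LocallyOfFiniteType f → QuasiCompact f → IsIntegral Y →
      ∀ (W : Scheme.{0}) (j : W ⟶ 𝔸(Fin 1; Y)), IsOpenImmersion j →
      ∀ (w : W) (W' : W.Opens), w ∈ W' →
      ∀ (Z : Scheme.{0}) (π : Z ⟶ (W' : Scheme.{0})), IsResolution π →
      ∃ U : Y.Opens, (𝔸(Fin 1; Y) ↘ Y).base (j.base w) ∈ U ∧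
        ∃ (U' : Scheme.{0}) (g : U' ⟶ (U : Scheme.{0})), IsProper g ∧ IsBirational g ∧
          ∀ u' : U', (g ≫ U.ι).base u' = (𝔸(Fin 1; Y) ↘ Y).base (j.base w) →
            ∃ (V : Z.Opens) (a : (V : Scheme.{0}) ⟶ U') (v : V),
              Flat a ∧ a.base v = u' ∧
              a ≫ g ≫ U.ι = V.ι ≫ π ≫ W'.ι ≫ j ≫ (𝔸(Fin 1; Y) ↘ Y)) :
    ∀ p : ℕ, p.Prime → ∀ (Y : Scheme.{0}) (f : Y ⟶ Spec (.of (ZMod p))),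
      IsSeparated f → LocallyOfFiniteType f → QuasiCompact f → IsIntegral Y →
      ∀ (W : Scheme.{0}) (j : W ⟶ 𝔸(Fin 1; Y)), IsOpenImmersion j → ∀ w : W,
      (∃ W' : W.Opens, w ∈ W' ∧ Scheme.HasResolution (W' : Scheme.{0})) →
      ∃ U : Y.Opens, (𝔸(Fin 1; Y) ↘ Y).base (j.base w) ∈ U ∧
        Scheme.HasResolution (U : Scheme.{0}) := by
  intro p hp Y f hs hl hq hi W j hj w ⟨W', hw, Z, π, hres⟩
  obtain ⟨U, hyU, U', g, hg, hb, hcharts⟩ := h3 p hp Y f hs hl hq hi W j hj w W' hw Z π hres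
  set y : ↥Y := (𝔸(Fin 1; Y) ↘ Y).base (j.base w) with hy
  -- the open `U` is locally of finite type over `𝔽_p`
  haveI : LocallyOfFiniteType (U.ι ≫ f) := inferInstance
  -- flat charts along the fibre of `g` over `⟨y, hyU⟩`, with regular stalks
  have hcharts' : ∀ u' : U', g.base u' = ⟨y, hyU⟩ →
      ∃ (V : Scheme.{0}) (a : V ⟶ U') (v : V),
        Flat a ∧ a.base v = u' ∧ IsRegularLocalRing (V.presheaf.stalk v) := by
    intro u' hu'
    have hu'' : (g ≫ U.ι).base u' = y := by
      rw [Scheme.Hom.comp_base]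
      change U.ι.base (g.base u') = y
      rw [hu']
      exact Scheme.Opens.ι_apply (U := U) ⟨y, hyU⟩
    obtain ⟨V, a, v, hflat, hav, -⟩ := hcharts u' hu''
    refine ⟨(V : Scheme.{0}), a, v, hflat, hav, ?_⟩
    exact hres.isRegular.of_isOpenImmersion V.ι v
  obtain ⟨U₁, hyU₁, hres₁⟩ := h2 p hp (U : Scheme.{0}) (U.ι ≫ f) inferInstance ⟨y, hyU⟩ U' g hg hb
    hcharts'
  refine ⟨U.ι ''ᵁ U₁, ⟨⟨y, hyU⟩, hyU₁, rfl⟩, ?_⟩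
  exact Scheme.HasResolution.of_iso (U.ι.isoImage U₁).hom hres₁

/-- **The crux `ProductDescent`, assembled** (the only `sorry`s in its closure are the three
registered stubs): the vertical-lines principle and flat-chart descent give the case `s = 1`
(`productDescent_one`), and induction on `s` gives all `s`. -/
theorem ProductDescent_of :
    ((∀ p : ℕ, p.Prime → ∀ (Y : Scheme.{0}) (f : Y ⟶ Spec (.of (ZMod p))),
      IsSeparated f → LocallyOfFiniteType f → QuasiCompact f → IsIntegral Y →
      ∀ (W : Scheme.{0}) (j : W ⟶ 𝔸(Fin 1; Y)), IsOpenImmersion j → ∀ w : W,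
      (∃ W' : W.Opens, w ∈ W' ∧ Scheme.HasResolution (W' : Scheme.{0})) →
      ∃ U : Y.Opens, (𝔸(Fin 1; Y) ↘ Y).base (j.base w) ∈ U ∧
        Scheme.HasResolution (U : Scheme.{0})) →
    ∀ p : ℕ, p.Prime → ∀ (Y : Scheme.{0}) (f : Y ⟶ Spec (.of (ZMod p))),
      IsSeparated f → LocallyOfFiniteType f → QuasiCompact f → IsIntegral Y →
      ∀ (s : ℕ) (W : Scheme.{0}) (j : W ⟶ 𝔸(Fin s; Y)), IsOpenImmersion j → ∀ w : W,
      (∃ W' : W.Opens, w ∈ W' ∧ Scheme.HasResolution (W' : Scheme.{0})) →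
      ∃ U : Y.Opens, (𝔸(Fin s; Y) ↘ Y).base (j.base w) ∈ U ∧
        Scheme.HasResolution (U : Scheme.{0})) →
    (∀ p : ℕ, p.Prime → ∀ (X : Scheme.{0}) (f : X ⟶ Spec (.of (ZMod p))),
      LocallyOfFiniteType f → ∀ (x : X) (U' : Scheme.{0}) (g : U' ⟶ X),
      IsProper g → IsBirational g →
      (∀ u' : U', g.base u' = x → ∃ (V : Scheme.{0}) (a : V ⟶ U') (v : V),
          Flat a ∧ a.base v = u' ∧ IsRegularLocalRing (V.presheaf.stalk v)) →
      ∃ U₁ : X.Opens, x ∈ U₁ ∧ Scheme.HasResolution (U₁ : Scheme.{0})) →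
    (∀ p : ℕ, p.Prime → ∀ (Y : Scheme.{0}) (f : Y ⟶ Spec (.of (ZMod p))),
      IsSeparated f → LocallyOfFiniteType f → QuasiCompact f → IsIntegral Y →
      ∀ (W : Scheme.{0}) (j : W ⟶ 𝔸(Fin 1; Y)), IsOpenImmersion j →
      ∀ (w : W) (W' : W.Opens), w ∈ W' →
      ∀ (Z : Scheme.{0}) (π : Z ⟶ (W' : Scheme.{0})), IsResolution π →
      ∃ U : Y.Opens, (𝔸(Fin 1; Y) ↘ Y).base (j.base w) ∈ U ∧
        ∃ (U' : Scheme.{0}) (g : U' ⟶ (U : Scheme.{0})), IsProper g ∧ IsBirational g ∧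
          ∀ u' : U', (g ≫ U.ι).base u' = (𝔸(Fin 1; Y) ↘ Y).base (j.base w) →
            ∃ (V : Z.Opens) (a : (V : Scheme.{0}) ⟶ U') (v : V),
              Flat a ∧ a.base v = u' ∧
              a ≫ g ≫ U.ι = V.ι ≫ π ≫ W'.ι ≫ j ≫ (𝔸(Fin 1; Y) ↘ Y)) →
    ProductDescent := by
  intro h1 h2 h3 p
  exact h1 (productDescent_one h2 h3) p

/-- The same composition with the stubs plugged in (its only `sorry`s are the three stubs). -/
theorem ProductDescent_proof : ProductDescent :=
  ProductDescent_of stub_affineInduction stub_resolutionOfFlatCharts stub_verticalLines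

end Summit.ResolutionOfSingularities.ResolutionOfSingularities.Cruxes.ProductDescent.Lines.VerticalLines

end
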